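import Literature.NumberTheory.LFunctions.WeilCriterionConverse
import Literature.NumberTheory.LFunctions.WeilCriterionProofs
import Literature.NumberTheory.LFunctions.WeilGroundEnergyProofs
import Literature.NumberTheory.LFunctions.UniformWeilPositivityRH
import Literature.NumberTheory.LFunctions.WeilWindowSuzukiProofs
import Literature.NumberTheory.LFunctions.WeilWindowSuzukiContinuityProofs
import Literature.NumberTheory.LFunctions.WeilLineZerosDensity
import Literature.NumberTheory.LFunctions.WeilArchimedeanMoments
import Literature.NumberTheory.LFunctions.WeilLineSamplingBessel
import Literature.NumberTheory.LFunctions.DirichletPolynomialGallagher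
import Literature.NumberTheory.LFunctions.WeilMellinInversion
import Literature.NumberTheory.LFunctions.ZetaZerosJensen
import Literature.NumberTheory.LFunctions.ZetaZerosReflection
import Summits.RiemannHypothesis.RiemannHypothesis.Statement
import Summits.RiemannHypothesis.RiemannHypothesis.Theorems.WeilCombCombShapeDetection
import HarnessLib

/-!
# Exponential slack in Weil's criterion, I: the growth bound on the dipole series

Solo programme `solo-RiemannHypothesis-informed`, session 2 — part of the exact-thermometer
package; the overview, the main theorem `width_iff_weilQuadratic_sobolev_subexp` and the
references are in `SoloInformedQuasiWeil.lean`. Everything here is proved (no named facts).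

Bombieri's translation–polarisation argument with slack and centred dipoles: a windowed
quasi-positivity hypothesis `Re Q(φ) ≥ -C e^{κ a} ‖φ‖₂²` on `[-a, a]` bounds the generalised
Dirichlet series `B_g(x) = ∑_ρ m(ρ) ĝ(ρ) conj ĝ(1-ρ̄) e^{(ρ-1/2)x}` by `O_g(e^{κx/2})`
(`norm_expSum_le_of_exp_lower`), whence no zero has `|Re ρ - 1/2| > κ/2`
(`abs_re_sub_half_le_of_zeroForm_exp_lower`, via the tilted Laplace lemma
`sum_fiber_eq_zero_of_exp_growth`).
-/

noncomputable section

open Complex Filter Set MeasureTheory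
open scoped Real Topology ComplexConjugate ArithmeticFunction.vonMangoldt

namespace Summit.RiemannHypothesis.RiemannHypothesis.Theorems

open Literature.NumberTheory.LFunctions Literature.NumberTheory.LFunctions.WeilConverse

/-! ## A tilted Laplace-transform lemma: growth `e^{κ x}` kills the modes of real part `> κ` -/

/-- **Exponentially bounded generalized power sums have no modes beyond the growth rate.** If
`F(x) = ∑ᵢ cᵢ e^{λᵢ x}` (`∑ ‖cᵢ‖ < ∞`, `Re λᵢ ≤ R`, `(λᵢ)` locally finite) satisfies
`‖F(x)‖ ≤ M e^{κ x}` for `x ≥ 0`, then for every `μ` with `Re μ > κ` the coefficients on the fibre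
`{i | λᵢ = μ}` sum to zero (apply `BoundedPowerSum.sum_fiber_eq_zero_of_exp` to the bounded series
`e^{-κ x} F(x) = ∑ᵢ cᵢ e^{(λᵢ - κ) x}`). [folklore] -/
theorem sum_fiber_eq_zero_of_exp_growth {ι : Type*} [Countable ι] {lam c : ι → ℂ} {R : ℝ}
    (hc : Summable fun i ↦ ‖c i‖) (hR : ∀ i, (lam i).re ≤ R)
    (hlf : ∀ z : ℂ, ∃ ε > 0, {i | lam i ∈ Metric.ball z ε}.Finite) {κ M : ℝ}
    (hM : ∀ x : ℝ, 0 ≤ x → ‖∑' i, c i * cexp (lam i * x)‖ ≤ M * Real.exp (κ * x))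
    {μ : ℂ} (hμ : κ < μ.re) (s : Finset ι) (hs : ∀ i, i ∈ s ↔ lam i = μ) :
    ∑ i ∈ s, c i = 0 := by
  refine Literature.Analysis.Complex.BoundedPowerSum.sum_fiber_eq_zero_of_exp
    (lam := fun i ↦ lam i - κ) (R := R - κ) (M := M) hc
    (fun i ↦ by simp only [sub_re, ofReal_re]; linarith [hR i]) (fun z ↦ ?_) (fun x hx ↦ ?_)
    (μ := μ - κ) (by simp only [sub_re, ofReal_re]; linarith) s
    (fun i ↦ by rw [hs i]; exact (sub_left_inj).symm)
  · obtain ⟨ε, hε, hfin⟩ := hlf (z + κ)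
    refine ⟨ε, hε, hfin.subset fun i hi ↦ ?_⟩
    simp only [mem_setOf_eq, Metric.mem_ball, dist_eq_norm] at hi ⊢
    rwa [show lam i - κ - z = lam i - (z + κ) by ring] at hi
  · have key : ∑' i, c i * cexp ((lam i - κ) * x) =
        cexp (-(κ * x : ℝ) : ℂ) * ∑' i, c i * cexp (lam i * x) := by
      rw [← tsum_mul_left]
      refine tsum_congr fun i ↦ ?_
      rw [mul_left_comm, ← Complex.exp_add]
      congr 2
      push_cast
      ring
    rw [key, norm_mul, Complex.norm_exp, neg_re, Complex.ofReal_re]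
    calc Real.exp (-(κ * x)) * ‖∑' i, c i * cexp (lam i * x)‖
        ≤ Real.exp (-(κ * x)) * (M * Real.exp (κ * x)) :=
          mul_le_mul_of_nonneg_left (hM x hx) (Real.exp_pos _).le
      _ = M := by rw [Real.exp_neg]; field_simp

/-! ## Translation invariance of the zero-side pairing -/

/-- `P_{g_y}(ρ) = P_g(ρ)`: the pairing `ĝ(ρ) conj ĝ(1 - ρ̄)` is invariant under translation of
`g` (the factors `e^{(ρ-1/2)y}` and `conj e^{(1/2-ρ̄)y} = e^{(1/2-ρ)y}` cancel since `y` is real).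
[folklore] -/
theorem pairCoeff_weilTranslate (g : ℝ → ℂ) (y : ℝ) (ρ : ℂ) :
    pairCoeff (weilTranslate g y) ρ = pairCoeff g ρ := by
  have hY : conj (cexp ((1 - conj ρ - 1 / 2) * y)) = cexp ((1 / 2 - ρ) * y) := by
    rw [← Complex.exp_conj]
    congr 1
    simp only [map_mul, map_sub, map_one, map_div₀, map_ofNat, Complex.conj_conj,
      Complex.conj_ofReal]
    ring
  have hXY : cexp ((ρ - 1 / 2) * y) * cexp ((1 / 2 - ρ) * y) = 1 := by
    rw [← Complex.exp_add, ← Complex.exp_zero]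
    congr 1
    ring
  rw [pairCoeff, pairCoeff, weilMellin_weilTranslate, weilMellin_weilTranslate, map_mul, hY]
  linear_combination weilMellin g ρ * conj (weilMellin g (1 - conj ρ)) * hXY

/-- `Q(g_y) = Q(g)`: the zero-side form is translation invariant. [folklore] -/
theorem zeroForm_weilTranslate (g : ℝ → ℂ) (y : ℝ) :
    zeroForm (weilTranslate g y) = zeroForm g := by
  unfold zeroForm
  simp_rw [pairCoeff_weilTranslate]

/-- `B_{g_y}(x) = B_g(x)`: the exponential series is translation invariant. [folklore] -/
theorem expSum_weilTranslate (g : ℝ → ℂ) (y x : ℝ) :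
    expSum (weilTranslate g y) x = expSum g x := by
  unfold expSum
  simp_rw [pairCoeff_weilTranslate]

/-- The translate of a function supported in `[u, v]` is supported in `[u + y, v + y]`.
[folklore] -/
theorem tsupport_weilTranslate_subset {g : ℝ → ℂ} {u v : ℝ} (h : tsupport g ⊆ Icc u v)
    (y : ℝ) : tsupport (weilTranslate g y) ⊆ Icc (u + y) (v + y) := by
  intro t ht
  have e : weilTranslate g y = g ∘ Homeomorph.addRight (-y) := by
    ext s
    simp [weilTranslate, sub_eq_add_neg]
  rw [e, tsupport_comp_eq_preimage] at ht
  have h2 : t + -y ∈ Icc u v := by simpa using h ht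
  simp only [mem_Icc] at h2 ⊢
  constructor <;> linarith [h2.1, h2.2]

/-- A compactly supported function on `ℝ` is supported in some symmetric window `[-b, b]`,
`b ≥ 0`. [folklore] -/
theorem exists_tsupport_subset_Icc {g : ℝ → ℂ} (hg : HasCompactSupport g) :
    ∃ b : ℝ, 0 ≤ b ∧ tsupport g ⊆ Icc (-b) b := by
  obtain ⟨r, hr⟩ := hg.isCompact.isBounded.subset_closedBall 0
  refine ⟨|r|, abs_nonneg r, hr.trans fun t ht ↦ ?_⟩
  rw [Metric.mem_closedBall, Real.dist_eq, sub_zero] at ht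
  exact abs_le.1 (ht.trans (le_abs_self r))

/-- `∫ |g_y|² = ∫ |g|²`. [folklore] -/
theorem integral_norm_sq_weilTranslate (g : ℝ → ℂ) (y : ℝ) :
    ∫ t : ℝ, ‖weilTranslate g y t‖ ^ 2 = ∫ t : ℝ, ‖g t‖ ^ 2 :=
  integral_sub_right_eq_self (fun t : ℝ ↦ ‖g t‖ ^ 2) y

/-! ## The growth bound on `B_g` under windowed quasi-positivity -/

/-- **Slack polarisation.** Suppose `Re Q(φ) ≥ -C e^{κ a} ‖φ‖₂²` for every test `φ` supported in
`[-a, a]`, `a ≥ a₀` (`κ ≥ 0`). Then for a test `g` supported in `[-b, b]` (`b ≥ 0`) and `x ≥ 0`,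
`|B_g(x)| ≤ (|Re Q(g)| + 2 C⁺ e^{κ(|a₀| + b)} ‖g‖₂²) · e^{(κ/2) x}`: apply the hypothesis on the
window of half-width `max a₀ (b + x/2)` to `g₁ + c g₁(· - x)`, `g₁ = g(· + x/2)`,
`c = -conj B_g(x)/|B_g(x)|`, whose zero-side form is `2 Re Q(g) - 2|B_g(x)|`
(`zeroForm_translateMix`) and whose `L²`-mass is `≤ 4‖g‖₂²`. [folklore] -/
theorem norm_expSum_le_of_exp_lower {κ C a₀ : ℝ} (hκ : 0 ≤ κ)
    (H : ∀ a : ℝ, a₀ ≤ a → ∀ φ : ℝ → ℂ, IsWeilTest φ → tsupport φ ⊆ Icc (-a) a →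
      -(C * Real.exp (κ * a)) * ∫ t : ℝ, ‖φ t‖ ^ 2 ≤ (zeroForm φ).re)
    {g : ℝ → ℂ} (hg : IsWeilTest g) {b : ℝ} (hb : 0 ≤ b) (hsupp : tsupport g ⊆ Icc (-b) b)
    {x : ℝ} (hx : 0 ≤ x) :
    ‖expSum g x‖ ≤ (|(zeroForm g).re| + 2 * max C 0 * Real.exp (κ * (|a₀| + b)) *
      ∫ t : ℝ, ‖g t‖ ^ 2) * Real.exp (κ / 2 * x) := by
  set N : ℝ := ∫ t : ℝ, ‖g t‖ ^ 2 with hN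
  have hN0 : 0 ≤ N := integral_nonneg fun _ ↦ by positivity
  set B := expSum g x with hBdef
  have hE1 : 1 ≤ Real.exp (κ / 2 * x) := Real.one_le_exp (by positivity)
  have hC0 : 0 ≤ max C 0 := le_max_right _ _
  by_cases hB : B = 0
  · rw [hB, norm_zero]; positivity
  -- the recentred test function and its invariants
  set g₁ : ℝ → ℂ := weilTranslate g (-(x / 2)) with hg₁
  have hg₁t : IsWeilTest g₁ := hg.weilTranslate _
  have hQ₁ : zeroForm g₁ = zeroForm g := zeroForm_weilTranslate g _
  have hB₁ : expSum g₁ x = B := expSum_weilTranslate g _ x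
  have hA₁ : expSum' g₁ x = conj B := by
    rw [← hB₁, ← conj_expSum' g₁ x, Complex.conj_conj]
  have hs₁ : tsupport g₁ ⊆ Icc (-b + -(x / 2)) (b + -(x / 2)) := tsupport_weilTranslate_subset hsupp _
  have hI₁ : ∫ t : ℝ, ‖g₁ t‖ ^ 2 = N := integral_norm_sq_weilTranslate g _
  have hI₂ : ∫ t : ℝ, ‖g₁ (t - x)‖ ^ 2 = N := by
    rw [integral_sub_right_eq_self (fun t : ℝ ↦ ‖g₁ t‖ ^ 2) x, hI₁]
  -- the phase
  have hn0 : ‖B‖ ≠ 0 := norm_ne_zero_iff.2 hB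
  have hn : (‖B‖ : ℂ) ≠ 0 := by exact_mod_cast hn0
  set c : ℂ := -conj B / (‖B‖ : ℂ) with hc
  have hcB : c * B = -(‖B‖ : ℂ) := by
    rw [hc, div_mul_eq_mul_div, neg_mul, Complex.conj_mul', neg_div]
    congr 1
    rw [sq, mul_div_assoc, div_self hn, mul_one]
  have hcn : ‖c‖ = 1 := by
    rw [hc, norm_div, norm_neg, Complex.norm_conj, Complex.norm_real, Real.norm_eq_abs, abs_norm,
      div_self hn0]
  have hc1 : Complex.normSq c = 1 := by
    rw [Complex.normSq_eq_norm_sq, hcn, one_pow]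
  -- the window
  set a : ℝ := max a₀ (b + x / 2) with ha
  have ha₀ : a₀ ≤ a := le_max_left _ _
  have hba : b + x / 2 ≤ a := le_max_right _ _
  have ha_le : a ≤ |a₀| + b + x / 2 :=
    max_le (by linarith [le_abs_self a₀]) (by linarith [abs_nonneg a₀])
  -- the mixed test function lives on the window
  have hφt : IsWeilTest (translateMix g₁ c x) := isWeilTest_translateMix hg₁t c x
  have hφs : tsupport (translateMix g₁ c x) ⊆ Icc (-a) a := by
    have h2 : tsupport (fun t ↦ c * weilTranslate g₁ x t) ⊆ Icc (-a) a := by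
      refine tsupport_mul_subset_right.trans ?_
      refine (tsupport_weilTranslate_subset hs₁ x).trans (Icc_subset_Icc (by linarith) (by linarith))
    refine (tsupport_add _ _).trans (union_subset (hs₁.trans (Icc_subset_Icc ?_ ?_)) h2) <;>
      linarith
  -- its `L²`-mass is at most `4 ‖g‖₂²`
  have hpt : ∀ t, ‖translateMix g₁ c x t‖ ^ 2 ≤ 2 * ‖g₁ t‖ ^ 2 + 2 * ‖g₁ (t - x)‖ ^ 2 := by
    intro t
    have e : translateMix g₁ c x t = g₁ t + c * g₁ (t - x) := rfl
    have h1 : ‖g₁ t + c * g₁ (t - x)‖ ≤ ‖g₁ t‖ + ‖g₁ (t - x)‖ := by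
      calc ‖g₁ t + c * g₁ (t - x)‖ ≤ ‖g₁ t‖ + ‖c * g₁ (t - x)‖ := norm_add_le _ _
        _ = ‖g₁ t‖ + ‖g₁ (t - x)‖ := by rw [norm_mul, hcn, one_mul]
    rw [e]
    calc ‖g₁ t + c * g₁ (t - x)‖ ^ 2 ≤ (‖g₁ t‖ + ‖g₁ (t - x)‖) ^ 2 :=
          pow_le_pow_left₀ (norm_nonneg _) h1 2
      _ ≤ 2 * ‖g₁ t‖ ^ 2 + 2 * ‖g₁ (t - x)‖ ^ 2 := by
          nlinarith [sq_nonneg (‖g₁ t‖ - ‖g₁ (t - x)‖)]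
  have hφN : ∫ t : ℝ, ‖translateMix g₁ c x t‖ ^ 2 ≤ 4 * N := by
    have hi1 : Integrable fun t : ℝ ↦ ‖g₁ t‖ ^ 2 := hg₁t.integrable_norm_sq
    have hi2 : Integrable fun t : ℝ ↦ ‖g₁ (t - x)‖ ^ 2 := hi1.comp_sub_right x
    calc ∫ t : ℝ, ‖translateMix g₁ c x t‖ ^ 2
        ≤ ∫ t : ℝ, (2 * ‖g₁ t‖ ^ 2 + 2 * ‖g₁ (t - x)‖ ^ 2) :=
          integral_mono_of_nonneg (Eventually.of_forall fun t ↦ by positivity)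
            ((hi1.const_mul 2).add (hi2.const_mul 2)) (Eventually.of_forall hpt)
      _ = 4 * N := by
          rw [integral_add (hi1.const_mul 2) (hi2.const_mul 2), integral_const_mul,
            integral_const_mul, hI₂, hI₁]
          ring
  have hφN0 : 0 ≤ ∫ t : ℝ, ‖translateMix g₁ c x t‖ ^ 2 := integral_nonneg fun _ ↦ by positivity
  -- the hypothesis on the window, expanded
  have h0 := H a ha₀ _ hφt hφs
  rw [zeroForm_translateMix hg₁t c x, hQ₁, hA₁, hB₁, ← map_mul, hcB, hc1] at h0
  simp only [map_neg, Complex.conj_ofReal, Complex.ofReal_one, one_mul, add_re, neg_re,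
    Complex.ofReal_re] at h0
  -- `h0 : -(C e^{κa}) ∫|φ|² ≤ Re Q + (Re Q + (-‖B‖ + -‖B‖))`
  have hea : Real.exp (κ * a) ≤ Real.exp (κ * (|a₀| + b)) * Real.exp (κ / 2 * x) := by
    rw [← Real.exp_add]
    exact Real.exp_le_exp.2 (by nlinarith)
  have hea0 : 0 < Real.exp (κ * a) := Real.exp_pos _
  have h1 : -(max C 0 * Real.exp (κ * a)) * (4 * N) ≤
      -(C * Real.exp (κ * a)) * ∫ t : ℝ, ‖translateMix g₁ c x t‖ ^ 2 := by
    have hCle : C ≤ max C 0 := le_max_left _ _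
    have h3 : C * Real.exp (κ * a) * ∫ t : ℝ, ‖translateMix g₁ c x t‖ ^ 2 ≤
        max C 0 * Real.exp (κ * a) * ∫ t : ℝ, ‖translateMix g₁ c x t‖ ^ 2 :=
      mul_le_mul_of_nonneg_right (mul_le_mul_of_nonneg_right hCle hea0.le) hφN0
    have h4 : max C 0 * Real.exp (κ * a) * ∫ t : ℝ, ‖translateMix g₁ c x t‖ ^ 2 ≤
        max C 0 * Real.exp (κ * a) * (4 * N) :=
      mul_le_mul_of_nonneg_left hφN (mul_nonneg hC0 hea0.le)
    linarith
  have hQabs : (zeroForm g).re ≤ |(zeroForm g).re| * Real.exp (κ / 2 * x) :=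
    (le_abs_self _).trans (le_mul_of_one_le_right (abs_nonneg _) hE1)
  have h5 : max C 0 * Real.exp (κ * a) * N ≤
      max C 0 * Real.exp (κ * (|a₀| + b)) * N * Real.exp (κ / 2 * x) := by
    have := mul_le_mul_of_nonneg_left hea hC0
    have := mul_le_mul_of_nonneg_right this hN0
    linarith [this]
  nlinarith [h0, h1, hQabs, h5, norm_nonneg B]

/-! ## No zeros beyond the growth rate -/

/-- **`m(ρ₀) P_g(ρ₀) = 0` whenever `Re ρ₀ - 1/2 > κ/2`**, for every test function `g`, under the
windowed quasi-positivity hypothesis with exponent `κ ≥ 0` (the growth bound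
`norm_expSum_le_of_exp_lower` fed into `sum_fiber_eq_zero_of_exp_growth`; the exponents
`ρ - 1/2` of `B_g` are locally finite and the fibre over `ρ₀ - 1/2` is `{ρ₀}`). [folklore] -/
theorem order_mul_pairCoeff_eq_zero_of_exp_lower {κ C a₀ : ℝ} (hκ : 0 ≤ κ)
    (H : ∀ a : ℝ, a₀ ≤ a → ∀ φ : ℝ → ℂ, IsWeilTest φ → tsupport φ ⊆ Icc (-a) a →
      -(C * Real.exp (κ * a)) * ∫ t : ℝ, ‖φ t‖ ^ 2 ≤ (zeroForm φ).re)
    {g : ℝ → ℂ} (hg : IsWeilTest g) {ρ₀ : ℂ} (hρ₀ : ρ₀ ∈ ZetaZeros.riemannZetaNontrivialZeros)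
    (hre : κ / 2 < ρ₀.re - 1 / 2) :
    (riemannZetaZeroOrder ρ₀ : ℂ) * pairCoeff g ρ₀ = 0 := by
  obtain ⟨b, hb, hsupp⟩ := exists_tsupport_subset_Icc hg.2
  have h := sum_fiber_eq_zero_of_exp_growth (ι := ZetaZeros.riemannZetaNontrivialZeros)
    (c := fun ρ ↦ (riemannZetaZeroOrder (ρ : ℂ) : ℂ) * pairCoeff g ρ)
    (lam := fun ρ ↦ (ρ : ℂ) - 1 / 2) (R := 1 / 2)
    (M := |(zeroForm g).re| + 2 * max C 0 * Real.exp (κ * (|a₀| + b)) * ∫ t : ℝ, ‖g t‖ ^ 2)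
    (summable_norm_pairCoeff hg) (fun ρ ↦ (le_abs_self _).trans (abs_re_sub_half_le ρ.2))
    (fun z ↦ ?_) (κ := κ / 2) (fun x hx ↦ norm_expSum_le_of_exp_lower hκ H hg hb hsupp hx)
    (μ := ρ₀ - 1 / 2) (by simpa [sub_re] using hre) {⟨ρ₀, hρ₀⟩} (fun ρ ↦ ?_)
  · simpa using h
  · refine ⟨1, one_pos, ?_⟩
    refine ((riemannZetaNontrivialZeros_finite_inter_ball (z + 1 / 2) 1).preimage
      (Subtype.val_injective.injOn)).subset fun ρ hρ ↦ ?_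
    simp only [mem_setOf_eq, Metric.mem_ball, dist_eq_norm] at hρ
    refine ⟨ρ.2, ?_⟩
    rw [Metric.mem_ball, dist_eq_norm]
    rwa [show (ρ : ℂ) - (z + 1 / 2) = (ρ : ℂ) - 1 / 2 - z by ring]
  · rw [Finset.mem_singleton, sub_left_inj]
    constructor
    · rintro rfl; rfl
    · intro h; exact Subtype.ext h

/-- **One-sided strip bound**: under windowed quasi-positivity with exponent `κ ≥ 0` (zero-side
form), every non-trivial zero has `Re ρ - 1/2 ≤ κ/2` (a narrow bump `g` has `Re ĝ > 0` on the
horizontal line through `ρ` and `1 - ρ̄`, so `m(ρ) P_g(ρ) ≠ 0`). [folklore] -/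
theorem re_sub_half_le_of_zeroForm_exp_lower {κ C a₀ : ℝ} (hκ : 0 ≤ κ)
    (H : ∀ a : ℝ, a₀ ≤ a → ∀ φ : ℝ → ℂ, IsWeilTest φ → tsupport φ ⊆ Icc (-a) a →
      -(C * Real.exp (κ * a)) * ∫ t : ℝ, ‖φ t‖ ^ 2 ≤ (zeroForm φ).re)
    {ρ : ℂ} (hρ : ρ ∈ ZetaZeros.riemannZetaNontrivialZeros) : ρ.re - 1 / 2 ≤ κ / 2 := by
  by_contra hre
  push Not at hre
  obtain ⟨g, hg, hpos⟩ := exists_isWeilTest_re_weilMellin_pos ρ.im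
  have h := order_mul_pairCoeff_eq_zero_of_exp_lower hκ H hg hρ hre
  have hm : (riemannZetaZeroOrder ρ : ℂ) ≠ 0 := by
    have := ZetaZeros.riemannZetaNontrivialZeros.one_le_order hρ
    exact_mod_cast (by omega : riemannZetaZeroOrder ρ ≠ 0)
  have h1 : weilMellin g ρ ≠ 0 := by
    intro h0
    have := hpos ρ.re
    rw [show (ρ.re : ℂ) + ρ.im * I = ρ from Complex.re_add_im ρ, h0, Complex.zero_re] at this
    exact lt_irrefl _ this
  have h2 : weilMellin g (1 - conj ρ) ≠ 0 := by
    intro h0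
    have := hpos (1 - ρ.re)
    rw [show ((1 - ρ.re : ℝ) : ℂ) + ρ.im * I = 1 - conj ρ from ?_, h0, Complex.zero_re] at this
    · exact lt_irrefl _ this
    · apply Complex.ext <;> simp
  exact (mul_ne_zero hm (mul_ne_zero h1 ((map_ne_zero _).2 h2))) h

/-- **Strip bound, zero-side form**: under windowed quasi-positivity of the zero-side form with
exponent `κ ≥ 0`, every non-trivial zero satisfies `|Re ρ - 1/2| ≤ κ/2` (the one-sided bound
at `ρ` and at the reflected zero `1 - ρ̄`). [folklore] -/
theorem abs_re_sub_half_le_of_zeroForm_exp_lower {κ C a₀ : ℝ} (hκ : 0 ≤ κ)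
    (H : ∀ a : ℝ, a₀ ≤ a → ∀ φ : ℝ → ℂ, IsWeilTest φ → tsupport φ ⊆ Icc (-a) a →
      -(C * Real.exp (κ * a)) * ∫ t : ℝ, ‖φ t‖ ^ 2 ≤ (zeroForm φ).re)
    {ρ : ℂ} (hρ : ρ ∈ ZetaZeros.riemannZetaNontrivialZeros) : |ρ.re - 1 / 2| ≤ κ / 2 := by
  have h1 := re_sub_half_le_of_zeroForm_exp_lower hκ H hρ
  have h2 := re_sub_half_le_of_zeroForm_exp_lower hκ H
    (ZetaZeros.riemannZetaNontrivialZeros.one_sub_conj_mem hρ)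
  rw [one_sub_conj_re] at h2
  rw [abs_sub_le_iff]
  constructor <;> linarith

end Summit.RiemannHypothesis.RiemannHypothesis.Theorems
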